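import Summits.Ventures.PercRepro.S1CoreCapSpecFiveThin
import Summits.Ventures.PercRepro.S1CoreCapSpecFiveFour

/-!
# PercRepro — TOWARDS `Q*(6) = 16`: THE COST OF A LINE OVER A UNION (p1, gen 25)

The general accounting behind the instance `ν = 6` of the 4-circuit-cap spec. A line `L` placed over an already
covered set `U` is charged `lineCost w L U = |L| − max |L ∩ U| 2 + fat (L ∖ U)`: `|L| − 2` plus its new fat points
when it meets `U` in at most two points, its new points plus its new fat points otherwise, nothing when `L ⊆ U`.
Summed along a list (`costSum`, the head placed last) this is exactly `wsum (unionL l) − lineRank l`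
(`wsum_unionL_eq`), so the spec's cost clause reads `costSum w l ≤ ν` for every list of the configuration
(`costSum_le`). Consequences: a family of 3-point lines placed after a prefix `l₀` has the budget `ν − costSum l₀`
on `free + new fat` (`budget_of_prefix`, the master inequality of `S1CoreCapFreeSeq` with the prefix priced
exactly); under budget `1` two uncovered lines share their unique new point (`sdiff_eq_of_free_le_one`); under
budget `2` a third line is covered by two free ones (`subset_of_free_le_two`); the lines through a point, even a
point of `P₀`, form a free sequence (`freeCountR_eq_length_of_mem'`). `proofs/P1-S4-CAPBRIDGE.md` §17.
Axioms: standard.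
-/

namespace PercRepro

namespace S1

namespace FourCap

variable {β : Type} [DecidableEq β]

/-- **The cost of a line over a union**: `|L| − max |L ∩ U| 2 + fat (L ∖ U)`. -/
def lineCost (w : β → ℕ) (L U : Finset β) : ℕ := (L.card - max (L ∩ U).card 2) + fat w (L \ U)

/-- The cost of a list of lines (the head placed last), each over the union of the lines after it. -/
def costSum (w : β → ℕ) : List (Finset β) → ℕ
  | [] => 0
  | L :: l => costSum w l + lineCost w L (unionL l)

/-- The weight of a cons: the weight of the union plus the weight of the new points. -/
theorem wsum_unionL_cons (w : β → ℕ) (L : Finset β) (l : List (Finset β)) :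
    wsum w (unionL (L :: l)) = wsum w (unionL l) + wsum w (L \ unionL l) := by
  simp only [unionL]
  rw [Finset.union_comm, ← wsum_union_ge]

/-- The new points of a line of `≥ 2` points split as the rank increment plus `|L| − max |L ∩ U| 2`. -/
theorem card_sdiff_eq_min_add (L U : Finset β) (hL : 2 ≤ L.card) :
    (L \ U).card = min (L \ U).card (2 - min (L ∩ U).card 2) + (L.card - max (L ∩ U).card 2) := by
  have h := Finset.card_sdiff_add_card_inter L U
  omega

/-- **The cost identity**: for lines of `≥ 2` points with weights `1` or `2`,
`wsum (unionL l) = lineRank l + costSum w l`. -/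
theorem wsum_unionL_eq (w : β → ℕ) :
    ∀ l : List (Finset β), (∀ L ∈ l, ∀ v ∈ L, w v = 1 ∨ w v = 2) → (∀ L ∈ l, 2 ≤ L.card) →
      wsum w (unionL l) = lineRank l + costSum w l
  | [], _, _ => by simp [unionL, lineRank, costSum, wsum]
  | L :: l, hw, hc => by
    have ih := wsum_unionL_eq w l (fun L' hL' => hw L' (List.mem_cons_of_mem _ hL'))
      (fun L' hL' => hc L' (List.mem_cons_of_mem _ hL'))
    rw [wsum_unionL_cons, ih, wsum_eq_card_add_fat w (L \ unionL l)
      (fun v hv => hw L List.mem_cons_self v (Finset.mem_sdiff.1 hv).1),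
      card_sdiff_eq_min_add L (unionL l) (hc L List.mem_cons_self)]
    simp only [lineRank, costSum, lineCost]
    omega

/-- **The cost clause in cost form**: every list of lines of the configuration costs at most `ν`. -/
theorem costSum_le {w : β → ℕ} {ls : Finset (Finset β)} {ν : ℕ}
    (h1 : ∀ L ∈ ls, ∀ v ∈ L, w v = 1 ∨ w v = 2) (h2 : ∀ L ∈ ls, 2 ≤ L.card)
    (h4 : ∀ l : List (Finset β), l.Nodup → (∀ L ∈ l, L ∈ ls) → wsum w (unionL l) ≤ ν + lineRank l)
    (l : List (Finset β)) (hnd : l.Nodup) (hl : ∀ L ∈ l, L ∈ ls) : costSum w l ≤ ν := by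
  have h := h4 l hnd hl
  rw [wsum_unionL_eq w l (fun L hL => h1 L (hl L hL)) (fun L hL => h2 L (hl L hL))] at h
  omega

/-- A covered line costs nothing. -/
theorem lineCost_of_subset {w : β → ℕ} {L U : Finset β} (h : L ⊆ U) : lineCost w L U = 0 := by
  have h1 : L ∩ U = L := Finset.inter_eq_left.2 h
  have h2 : L \ U = ∅ := Finset.sdiff_eq_empty_iff_subset.2 h
  simp only [lineCost, h1, h2, fat, Finset.filter_empty, Finset.card_empty]
  omega

/-- A line of `≥ 3` points not covered costs at least `1`. -/
theorem one_le_lineCost {w : β → ℕ} {L U : Finset β} (h : ¬ L ⊆ U) (hL : 3 ≤ L.card) :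
    1 ≤ lineCost w L U := by
  have h1 := Finset.card_sdiff_add_card_inter L U
  have h2 : 0 < (L \ U).card := Finset.card_pos.2 (by
    obtain ⟨v, hvL, hvU⟩ := Finset.not_subset.1 h
    exact ⟨v, Finset.mem_sdiff.2 ⟨hvL, hvU⟩⟩)
  simp only [lineCost]
  omega

/-- A line meeting the union in at most two points costs `|L| − 2` plus its new fat points. -/
theorem lineCost_of_inter_le_two {w : β → ℕ} {L U : Finset β} (h : (L ∩ U).card ≤ 2) :
    lineCost w L U = L.card - 2 + fat w (L \ U) := by
  simp only [lineCost, max_eq_right h]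

/-- The cost of the first line of a list. -/
theorem lineCost_empty (w : β → ℕ) (L : Finset β) : lineCost w L ∅ = L.card - 2 + fat w L := by
  simp [lineCost]

/-- The cost is at least `|L| − |L ∩ U|` minus nothing when `|L ∩ U| ≥ 2`, in general at least the new points beyond
two. -/
theorem lineCost_ge {w : β → ℕ} (L U : Finset β) : L.card - max (L ∩ U).card 2 ≤ lineCost w L U :=
  Nat.le_add_right _ _

/-- The intersection with a union is bounded by the two intersections. -/
theorem card_inter_union_le (L A B : Finset β) : (L ∩ (A ∪ B)).card ≤ (L ∩ A).card + (L ∩ B).card := by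
  rw [Finset.inter_union_distrib_left]
  exact Finset.card_union_le _ _

/-- **The budget after a prefix**: for a list `l` of 3-point lines placed after a list `l₀` of the configuration,
`costSum l₀ + freeCountR (unionL l₀) l + fat (unionLR (unionL l₀) l) ≤ ν + fat (unionL l₀)`. -/
theorem budget_of_prefix {w : β → ℕ} {ls : Finset (Finset β)} {ν : ℕ}
    (h1 : ∀ L ∈ ls, ∀ v ∈ L, w v = 1 ∨ w v = 2) (h2 : ∀ L ∈ ls, 2 ≤ L.card)
    (h4 : ∀ l : List (Finset β), l.Nodup → (∀ L ∈ l, L ∈ ls) → wsum w (unionL l) ≤ ν + lineRank l)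
    (l₀ l : List (Finset β)) (hnd : (l ++ l₀).Nodup) (hls : ∀ L ∈ l ++ l₀, L ∈ ls) (h3 : ∀ L ∈ l, L.card = 3) :
    costSum w l₀ + freeCountR (unionL l₀) l + fat w (unionLR (unionL l₀) l) ≤ ν + fat w (unionL l₀) := by
  have h := freeCountR_add_fat_le h1 h4 l₀ l hnd hls h3
  have hl₀ : ∀ L ∈ l₀, L ∈ ls := fun L hL => hls L (List.mem_append_right _ hL)
  have hw := wsum_unionL_eq w l₀ (fun L hL => h1 L (hl₀ L hL)) (fun L hL => h2 L (hl₀ L hL))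
  have hc := wsum_eq_card_add_fat w (unionL l₀) (fun v hv => by
    obtain ⟨L, hL, hvL⟩ := mem_unionL_iff.1 hv
    exact h1 L (hl₀ L hL) v hvL)
  omega

/-- The union over `P₀` of an appended list. -/
theorem unionLR_append (P₀ : Finset β) (l l' : List (Finset β)) :
    unionLR P₀ (l ++ l') = unionLR (unionLR P₀ l') l := by
  induction l with
  | nil => rfl
  | cons L l ih => simp only [List.cons_append, unionLR, ih]

/-- The free count of an appended list: the free count of the tail over `P₀` plus that of the head over the
tail's union. -/
theorem freeCountR_append (P₀ : Finset β) (l l' : List (Finset β)) :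
    freeCountR P₀ (l ++ l') = freeCountR P₀ l' + freeCountR (unionLR P₀ l') l := by
  induction l with
  | nil => simp [freeCountR]
  | cons L l ih =>
    simp only [List.cons_append, freeCountR, ih, unionLR_append]
    omega

/-- **The lines through a point form a free sequence** (the point may lie in `P₀`): a list of distinct 3-point
lines through `v`, each meeting `P₀` in `≤ 1` point and pairwise sharing `≤ 1` point, has every line free — a
second point of the line off `P₀` lies on no other line through `v`. -/
theorem freeCountR_eq_length_of_mem' (P₀ : Finset β) {v : β} :
    ∀ l : List (Finset β), l.Nodup → (∀ L ∈ l, L.card = 3 ∧ v ∈ L ∧ (L ∩ P₀).card ≤ 1) →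
      (∀ L ∈ l, ∀ L' ∈ l, L ≠ L' → (L ∩ L').card ≤ 1) → freeCountR P₀ l = l.length
  | [], _, _, _ => rfl
  | L :: l, hnd, hall, hpair => by
    have ih := freeCountR_eq_length_of_mem' P₀ l (List.nodup_cons.1 hnd).2
      (fun L' hL' => hall L' (List.mem_cons_of_mem _ hL'))
      (fun L' hL' L'' hL'' hne => hpair L' (List.mem_cons_of_mem _ hL') L'' (List.mem_cons_of_mem _ hL'') hne)
    obtain ⟨hL3, hvL, hLP⟩ := hall L List.mem_cons_self
    have hsd : 1 < (L \ P₀).card := by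
      have := Finset.card_sdiff_add_card_inter L P₀
      omega
    obtain ⟨x, hx, hxv⟩ := Finset.exists_mem_ne hsd v
    have hxL : x ∈ L := (Finset.mem_sdiff.1 hx).1
    have hxP : x ∉ P₀ := (Finset.mem_sdiff.1 hx).2
    have hxl : ∀ L' ∈ l, x ∉ L' := by
      intro L' hL' hxL'
      have hne : L ≠ L' := fun h => (List.nodup_cons.1 hnd).1 (h ▸ hL')
      have hint := hpair L List.mem_cons_self L' (List.mem_cons_of_mem _ hL') hne
      have hvL' := (hall L' (List.mem_cons_of_mem _ hL')).2.1
      exact hxv (Finset.card_le_one.1 hint x (Finset.mem_inter.2 ⟨hxL, hxL'⟩) v (Finset.mem_inter.2 ⟨hvL, hvL'⟩))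
    rw [freeCountR_cons_of_new hxL hxP hxl, ih]
    rfl

/-- The lines of a family through a point (possibly of `P₀`) are at most the free budget. -/
theorem card_filter_le_of_freeCountR_le' (P₀ : Finset β) (T : Finset (Finset β)) (v : β)
    (hT : ∀ L ∈ T, L.card = 3 ∧ (L ∩ P₀).card ≤ 1)
    (hpair : ∀ L ∈ T, ∀ L' ∈ T, L ≠ L' → (L ∩ L').card ≤ 1) {k : ℕ}
    (hk : ∀ l : List (Finset β), l.Nodup → (∀ L ∈ l, L ∈ T) → freeCountR P₀ l ≤ k) :
    (T.filter (fun L => v ∈ L)).card ≤ k := by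
  set A := T.filter (fun L => v ∈ L) with hA
  have hmem : ∀ L ∈ A.toList, L ∈ T ∧ v ∈ L := fun L hL => Finset.mem_filter.1 (Finset.mem_toList.1 hL)
  have h := hk A.toList (Finset.nodup_toList A) (fun L hL => (hmem L hL).1)
  rw [freeCountR_eq_length_of_mem' P₀ A.toList (Finset.nodup_toList A)
    (fun L hL => ⟨(hT L (hmem L hL).1).1, (hmem L hL).2, (hT L (hmem L hL).1).2⟩)
    (fun L hL L' hL' hne => hpair L (hmem L hL).1 L' (hmem L' hL').1 hne), Finset.length_toList] at h
  exact h

/-- The free count of a list in which every line is free, as a list of lines through `v` placed after a list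
`l'`: `freeCountR P₀ (l ++ l') = freeCountR P₀ l' + l.length` when the lines of `l` each have a point off
`unionLR P₀ l'` and off the other lines of `l`. -/
theorem freeCountR_append_eq_length (P₀ : Finset β) {v : β} (l l' : List (Finset β)) (hnd : l.Nodup)
    (hall : ∀ L ∈ l, L.card = 3 ∧ v ∈ L ∧ (L ∩ unionLR P₀ l').card ≤ 1)
    (hpair : ∀ L ∈ l, ∀ L' ∈ l, L ≠ L' → (L ∩ L').card ≤ 1) :
    freeCountR P₀ (l ++ l') = freeCountR P₀ l' + l.length := by
  rw [freeCountR_append, freeCountR_eq_length_of_mem' (unionLR P₀ l') l hnd hall hpair]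

/-- **Under budget `1` two uncovered lines share their unique new point**: if `X` and `Y` are not covered by `P₀`,
share `≤ 1` point, and both orders have `≤ 1` free line, then `X ∖ P₀ = Y ∖ P₀` is a single point. -/
theorem sdiff_eq_of_free_le_one {P₀ X Y : Finset β} (hX : ¬ X ⊆ P₀) (hY : ¬ Y ⊆ P₀) (hXY : (X ∩ Y).card ≤ 1)
    (h : freeCountR P₀ [Y, X] ≤ 1) (h' : freeCountR P₀ [X, Y] ≤ 1) :
    X \ P₀ = Y \ P₀ ∧ (X \ P₀).card = 1 := by
  simp only [freeCountR, unionLR, if_neg hX, if_neg hY] at h h'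
  have hYX : Y ⊆ X ∪ P₀ := by
    by_contra hc
    simp [hc] at h
  have hXY' : X ⊆ Y ∪ P₀ := by
    by_contra hc
    simp [hc] at h'
  have h1 : X \ P₀ ⊆ X ∩ Y := by
    intro v hv
    have hv' := Finset.mem_sdiff.1 hv
    rcases Finset.mem_union.1 (hXY' hv'.1) with h | h
    · exact Finset.mem_inter.2 ⟨hv'.1, h⟩
    · exact absurd h hv'.2
  have h2 : Y \ P₀ ⊆ X ∩ Y := by
    intro v hv
    have hv' := Finset.mem_sdiff.1 hv
    rcases Finset.mem_union.1 (hYX hv'.1) with h | h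
    · exact Finset.mem_inter.2 ⟨h, hv'.1⟩
    · exact absurd h hv'.2
  have hpos : 0 < (X \ P₀).card := Finset.card_pos.2 (by
    obtain ⟨v, hvX, hvP⟩ := Finset.not_subset.1 hX
    exact ⟨v, Finset.mem_sdiff.2 ⟨hvX, hvP⟩⟩)
  have hpos' : 0 < (Y \ P₀).card := Finset.card_pos.2 (by
    obtain ⟨v, hvY, hvP⟩ := Finset.not_subset.1 hY
    exact ⟨v, Finset.mem_sdiff.2 ⟨hvY, hvP⟩⟩)
  have e1 : X \ P₀ = X ∩ Y := Finset.eq_of_subset_of_card_le h1 (by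
    have := Finset.card_le_card h1; omega)
  have e2 : Y \ P₀ = X ∩ Y := Finset.eq_of_subset_of_card_le h2 (by
    have := Finset.card_le_card h2; omega)
  refine ⟨e1.trans e2.symm, ?_⟩
  have := Finset.card_le_card h1
  omega

/-- **Under budget `2` a third line is covered by two free ones**. -/
theorem subset_of_free_le_two {P₀ X Y Z : Finset β} (hX : ¬ X ⊆ P₀) (hY : ¬ Y ⊆ X ∪ P₀)
    (h : freeCountR P₀ [Z, Y, X] ≤ 2) : Z ⊆ Y ∪ (X ∪ P₀) := by
  simp only [freeCountR, unionLR, if_neg hX, if_neg hY] at h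
  by_contra hZ
  simp [hZ] at h

end FourCap

end S1

end PercRepro
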